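import Literature.Computability.AlgebraicComplexity.BorderRankMatMulThreeLink
import Literature.Computability.AlgebraicComplexity.BorderRankMatMulThreeTriple
import HarnessLib

/-!
# Borel-fixed candidates of `⟨3,3,3⟩`: the dual description of the models

Topic `Literature/Computability/AlgebraicComplexity`. Semantics for the `(111)` test procedure of
`BorderRankMatMulThreeTriple.lean`:

* `MatMul3.tcode`, `MatMul3.tdecode` — triple codes `81a + 9b + c` of `A ⊗ B ⊗ C` coordinates;
* `MatMul3.Ker.TFunc.row`, `Ker.TFunc.ev`, `Ker.TFunc.ev_eq_sum` — a sparse functional as a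
  row vector and its value `∑_y row y · x y`;
* `MatMul3.dualModel p` — **the dual model of a profile code `p`**: vanishing at the non-root
  off-diagonal positions (`Ker.offRoot`) and the relations `Ker.relsOf` of every block diagonal;
* `MatMul3.model_le_dualModel` — the (span) model of a profile lies in the dual model of its code;
  hence `MatMul3.IsAdmissible.le_dualModel`: **an admissible `E` lies in the dual model of its
  encoded profile.**

## References

* A. Conner, A. Harper, J. M. Landsberg, *New lower bounds for matrix multiplication and `det₃`*,
  Forum Math. Pi 11 (2023) e17, arXiv:1911.07981 — §6. [ConnerHarperLandsberg2023]
-/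

noncomputable section

open scoped BigOperators

namespace Literature.Computability.AlgebraicComplexity

namespace BorderApolarity

namespace MatMul3

universe u

variable {K : Type u} [Field K]

/-! ## Triple codes -/

/-- Code `81a + 9b + c` of a coordinate of `A ⊗ B ⊗ C`. [folklore] -/
def tcode (y : I9' × I9' × I9') : ℕ := 81 * codeA y.1 + 9 * codeA y.2.1 + codeA y.2.2

/-- Decoding a triple code. [folklore] -/
def tdecode (s : ℕ) : I9' × I9' × I9' := (decode9 (s / 81), decode9 (s / 9 % 9), decode9 (s % 9))

/-- `tcode y < 729`. [folklore] -/
theorem tcode_lt (y : I9' × I9' × I9') : tcode y < 729 := by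
  have := codeA_lt y.1; have := codeA_lt y.2.1; have := codeA_lt y.2.2; simp only [tcode]; omega

/-- `tdecode (tcode y) = y`. [folklore] -/
theorem tdecode_tcode (y : I9' × I9' × I9') : tdecode (tcode y) = y := by
  have h1 := codeA_lt y.1; have h2 := codeA_lt y.2.1; have h3 := codeA_lt y.2.2
  have e1 : tcode y / 81 = codeA y.1 := by simp only [tcode]; omega
  have e2 : tcode y / 9 % 9 = codeA y.2.1 := by simp only [tcode]; omega
  have e3 : tcode y % 9 = codeA y.2.2 := by simp only [tcode]; omega
  simp only [tdecode, e1, e2, e3, decode9_codeA]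

/-- `tcode (tdecode s) = s` for `s < 729`. [folklore] -/
theorem tcode_tdecode {s : ℕ} (hs : s < 729) : tcode (tdecode s) = s := by
  simp only [tcode, tdecode]
  rw [codeA_decode9 (by omega), codeA_decode9 (Nat.mod_lt _ (by norm_num)),
    codeA_decode9 (Nat.mod_lt _ (by norm_num))]
  omega

/-- `tcode` is injective. [folklore] -/
theorem tcode_injective : Function.Injective tcode := fun y y' h => by
  rw [← tdecode_tcode y, h, tdecode_tcode]

namespace Ker

/-! ## Sparse functionals as row vectors -/

/-- The row vector of a sparse functional on triple codes. [folklore] -/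
def TFunc.row (φ : TFunc) : I9' × I9' × I9' → K := fun y => (φ.coef (tcode y) : K)

/-- The value of a sparse functional on a 3-array. [folklore] -/
def TFunc.ev (φ : TFunc) (x : I9' × I9' × I9' → K) : K :=
  (φ.map fun e => (e.2 : K) * x (tdecode e.1)).sum

/-- `coef` of a cons. [folklore] -/
theorem TFunc.coef_cons (e : ℕ × ℤ) (φ : TFunc) (s : ℕ) :
    TFunc.coef (e :: φ) s = (if e.1 = s then e.2 else 0) + TFunc.coef φ s := by
  simp only [TFunc.coef, List.filter_cons]
  by_cases h : e.1 = s
  · simp [h]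
  · simp [h]

/-- `coef` of the empty functional. [folklore] -/
@[simp] theorem TFunc.coef_nil (s : ℕ) : TFunc.coef [] s = 0 := rfl

/-- A functional with no entry at `s` has coefficient `0` there. [folklore] -/
theorem TFunc.coef_eq_zero_of_forall_ne {φ : TFunc} {s : ℕ} (h : ∀ e ∈ φ, e.1 ≠ s) : φ.coef s = 0 := by
  induction φ with
  | nil => rfl
  | cons e φ ih =>
    rw [TFunc.coef_cons, if_neg (h e (by simp)), zero_add]
    exact ih fun e' he' => h e' (by simp [he'])

/-- Row of a cons. [folklore] -/
theorem TFunc.row_cons (e : ℕ × ℤ) (φ : TFunc) (y : I9' × I9' × I9') :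
    TFunc.row (K := K) (e :: φ) y = (if e.1 = tcode y then (e.2 : K) else 0) + TFunc.row φ y := by
  simp only [TFunc.row, TFunc.coef_cons, Int.cast_add]
  split_ifs <;> simp

/-- **The value is the dot product with the row** (codes `< 729`). [folklore] -/
theorem TFunc.ev_eq_sum (φ : TFunc) (hφ : ∀ e ∈ φ, e.1 < 729) (x : I9' × I9' × I9' → K) :
    φ.ev x = ∑ y, φ.row y * x y := by
  induction φ with
  | nil => simp [TFunc.ev, TFunc.row]
  | cons e φ ih =>
    have he : e.1 < 729 := hφ e (by simp)
    have ih' := ih fun e' he' => hφ e' (by simp [he'])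
    simp only [TFunc.ev, List.map_cons, List.sum_cons] at ih' ⊢
    simp only [TFunc.row_cons, add_mul, Finset.sum_add_distrib]
    rw [ih']
    congr 1
    rw [Finset.sum_eq_single (tdecode e.1)]
    · rw [tcode_tdecode he, if_pos rfl]
    · intro y _ hy
      rw [if_neg, zero_mul]
      intro h
      apply hy
      rw [← tdecode_tcode y, ← h]
    · intro h; exact absurd (Finset.mem_univ _) h

/-- The value is additive in `x`. [folklore] -/
theorem TFunc.ev_add (φ : TFunc) (x x' : I9' × I9' × I9' → K) : φ.ev (x + x') = φ.ev x + φ.ev x' := by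
  induction φ with
  | nil => simp [TFunc.ev]
  | cons e φ ih =>
    simp only [TFunc.ev, List.map_cons, List.sum_cons, Pi.add_apply] at ih ⊢
    rw [ih]; ring

/-- The value is homogeneous in `x`. [folklore] -/
theorem TFunc.ev_smul (φ : TFunc) (c : K) (x : I9' × I9' × I9' → K) : φ.ev (c • x) = c * φ.ev x := by
  induction φ with
  | nil => simp [TFunc.ev]
  | cons e φ ih =>
    simp only [TFunc.ev, List.map_cons, List.sum_cons, Pi.smul_apply, smul_eq_mul] at ih ⊢
    rw [ih]; ring

end Ker

/-! ## The dual model of a profile code -/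

/-- **The dual model** of a profile code `p`: vanishing at the non-root off-diagonal positions and
the relations of every block diagonal. [cite: ConnerHarperLandsberg2023, §6] -/
def dualModel (p : List (List (ℕ × ℕ) × ℕ)) : Submodule K (I9' × I9' → K) where
  carrier := {v | (∀ j k i i' : Fin 3, Ker.offRoot p (3 * j + k) i i' = true → v (blk j k i i') = 0) ∧
    ∀ j k : Fin 3, ∀ r ∈ Ker.relsOf p (3 * j + k),
      ∑ i : Fin 3, ((r.getD i 0 : ℤ) : K) * v (blk j k i i) = 0}
  add_mem' {v w} hv hw := by
    refine ⟨fun j k i i' h => ?_, fun j k r hr => ?_⟩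
    · rw [Pi.add_apply, hv.1 j k i i' h, hw.1 j k i i' h, add_zero]
    · simp only [Pi.add_apply, mul_add, Finset.sum_add_distrib, hv.2 j k r hr, hw.2 j k r hr, add_zero]
  zero_mem' := ⟨fun _ _ _ _ _ => rfl, fun _ _ _ _ => by simp⟩
  smul_mem' c {v} hv := by
    refine ⟨fun j k i i' h => ?_, fun j k r hr => ?_⟩
    · rw [Pi.smul_apply, hv.1 j k i i' h, smul_zero]
    · simp only [Pi.smul_apply, smul_eq_mul, mul_left_comm _ c, ← Finset.mul_sum, hv.2 j k r hr,
        mul_zero]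

/-- Membership in the dual model. [folklore] -/
theorem mem_dualModel {p : List (List (ℕ × ℕ) × ℕ)} {v : I9' × I9' → K} :
    v ∈ dualModel (K := K) p ↔
      (∀ j k i i' : Fin 3, Ker.offRoot p (3 * j + k) i i' = true → v (blk j k i i') = 0) ∧
        ∀ j k : Fin 3, ∀ r ∈ Ker.relsOf p (3 * j + k),
          ∑ i : Fin 3, ((r.getD i 0 : ℤ) : K) * v (blk j k i i) = 0 := Iff.rfl

/-! ## The model of a profile lies in the dual model of its code -/

/-- The block of the code of a profile. [folklore] -/
theorem blockOf_encodeProf (Rf : Fin 3 × Fin 3 → Finset (Fin 3 × Fin 3)) (δf : Fin 3 × Fin 3 → ℕ)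
    (j k : Fin 3) : Ker.blockOf (encodeProf Rf δf) (3 * j + k) = (encodeR (Rf (j, k)), δf (j, k)) := by
  rw [Ker.blockOf, show 3 * (j : ℕ) + k = jkCode (j, k) from rfl, encodeProf_getD]

/-- `offRoot` of the code of a profile: `i ≠ i'` and `(i,i') ∉ R_{jk}`. [folklore] -/
theorem offRoot_encodeProf {Rf : Fin 3 × Fin 3 → Finset (Fin 3 × Fin 3)} {δf : Fin 3 × Fin 3 → ℕ}
    {j k i i' : Fin 3} (h : Ker.offRoot (encodeProf Rf δf) (3 * j + k) i i' = true) :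
    i ≠ i' ∧ (i, i') ∉ Rf (j, k) := by
  rw [Ker.offRoot, blockOf_encodeProf, Bool.and_eq_true, decide_eq_true_eq, Bool.not_eq_true',
    contains_encodeR, decide_eq_false_iff_not] at h
  exact ⟨fun heq => h.1 (congrArg Fin.val heq), h.2⟩

/-- **Every diagonal generator of a type satisfies the relations of its type** (finite check).
[cite: ConnerHarperLandsberg2023, §6] -/
theorem drels_dgens (R : Finset (Fin 3 × Fin 3)) (δ : ℕ) (d g : Fin 3 → K)
    (hg : g ∈ dgens (dtypeOf R δ) d) (r : List ℤ) (hr : r ∈ Ker.drels (Ker.dcode (encodeR R) δ)) :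
    ∑ i : Fin 3, ((r.getD i 0 : ℤ) : K) * g i = 0 := by
  rw [dcode_encodeR] at hr
  revert hg hr
  cases dtypeOf R δ <;> intro hg hr <;>
    simp only [dgens, Set.mem_insert_iff, Set.mem_singleton_iff, Ker.drels] at hg hr
  · simp only [if_true, List.mem_cons, List.not_mem_nil, or_false] at hr
    subst hg
    rcases hr with rfl | rfl <;> simp [Fin.sum_univ_three]
  · simp only [show (1 : ℕ) ≠ 0 from one_ne_zero, if_false, if_true, List.mem_singleton] at hr
    subst hr
    rcases hg with rfl | rfl <;> simp [Fin.sum_univ_three]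
  · simp only [show (2 : ℕ) ≠ 0 from two_ne_zero, show (2 : ℕ) ≠ 1 from by decide, if_false, if_true,
      List.mem_singleton] at hr
    subst hr
    rcases hg with rfl | rfl <;> simp [Fin.sum_univ_three]
  · simp only [show (3 : ℕ) ≠ 0 from by decide, show (3 : ℕ) ≠ 1 from by decide,
      show (3 : ℕ) ≠ 2 from by decide, if_false, if_true, List.mem_singleton] at hr
    subst hr
    rcases hg with rfl | rfl <;> simp [Fin.sum_univ_three]; norm_num
  · simp only [show (4 : ℕ) ≠ 0 from by decide, show (4 : ℕ) ≠ 1 from by decide,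
      show (4 : ℕ) ≠ 2 from by decide, show (4 : ℕ) ≠ 3 from by decide, if_false, if_true,
      List.mem_singleton] at hr
    subst hr
    rcases hg with rfl | rfl <;> simp [Fin.sum_univ_three]; norm_num
  · simp only [show (5 : ℕ) ≠ 0 from by decide, show (5 : ℕ) ≠ 1 from by decide,
      show (5 : ℕ) ≠ 2 from by decide, show (5 : ℕ) ≠ 3 from by decide,
      show (5 : ℕ) ≠ 4 from by decide, if_false, List.not_mem_nil] at hr
  · simp only [show (6 : ℕ) ≠ 0 from by decide, show (6 : ℕ) ≠ 1 from by decide,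
      show (6 : ℕ) ≠ 2 from by decide, show (6 : ℕ) ≠ 3 from by decide,
      show (6 : ℕ) ≠ 4 from by decide, if_false, List.not_mem_nil] at hr

/-- **The model block lies in the dual model** (roots off-diagonal). [cite: ConnerHarperLandsberg2023, §6] -/
theorem blockModel_le_dualModel (Rf : Fin 3 × Fin 3 → Finset (Fin 3 × Fin 3)) (δf : Fin 3 × Fin 3 → ℕ)
    (hoff : ∀ jk, ∀ ii' ∈ Rf jk, ii'.1 ≠ ii'.2) (jk : Fin 3 × Fin 3) (d : Fin 3 → K) :
    blockModel jk.1 jk.2 (Rf jk) (δf jk) d ≤ dualModel (encodeProf Rf δf) := by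
  obtain ⟨j₀, k₀⟩ := jk
  refine sup_le (Submodule.span_le.2 ?_) ?_
  · rintro _ ⟨⟨i₀, i₀'⟩, hmem, rfl⟩
    have hne : i₀ ≠ i₀' := hoff (j₀, k₀) _ hmem
    refine ⟨fun j k i i' h => ?_, fun j k r hr => ?_⟩
    · obtain ⟨hii', hnot⟩ := offRoot_encodeProf h
      change unitVec j₀ k₀ i₀ i₀' (blk j k i i') = 0
      rw [unitVec_apply, if_neg]
      intro heq
      obtain ⟨rfl, rfl, rfl, rfl⟩ := blk_inj.1 heq
      exact hnot hmem
    · refine Finset.sum_eq_zero fun i _ => ?_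
      change _ * unitVec j₀ k₀ i₀ i₀' (blk j k i i) = 0
      rw [unitVec_apply, if_neg, mul_zero]
      intro heq
      obtain ⟨-, -, h3, h4⟩ := blk_inj.1 heq
      exact hne (h3.symm.trans h4)
  · rw [Submodule.map_le_iff_le_comap, dmodel, Submodule.span_le]
    intro g hg
    rw [SetLike.mem_coe, Submodule.mem_comap]
    change diagVec j₀ k₀ g ∈ dualModel (encodeProf Rf δf)
    refine ⟨fun j k i i' h => ?_, fun j k r hr => ?_⟩
    · obtain ⟨hii', -⟩ := offRoot_encodeProf h
      rw [diagVec_blk, if_neg]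
      rintro ⟨-, -, h3⟩
      exact hii' h3
    · by_cases hjk : k = k₀ ∧ j = j₀
      · obtain ⟨rfl, rfl⟩ := hjk
        rw [Ker.relsOf, blockOf_encodeProf] at hr
        simp only [diagVec_blk, true_and, if_true]
        exact drels_dgens (Rf (j, k)) (δf (j, k)) d g hg r hr
      · refine Finset.sum_eq_zero fun i _ => ?_
        rw [diagVec_blk, if_neg, mul_zero]
        rintro ⟨h1, h2, -⟩
        exact hjk ⟨h1, h2⟩

/-- **The model of a profile lies in the dual model of its code.** [cite: ConnerHarperLandsberg2023, §6] -/
theorem model_le_dualModel (Rf : Fin 3 × Fin 3 → Finset (Fin 3 × Fin 3)) (δf : Fin 3 × Fin 3 → ℕ)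
    (hoff : ∀ jk, ∀ ii' ∈ Rf jk, ii'.1 ≠ ii'.2) (df : Fin 3 × Fin 3 → Fin 3 → K) :
    model Rf δf df ≤ dualModel (encodeProf Rf δf) :=
  iSup_le fun jk => blockModel_le_dualModel Rf δf hoff jk (df jk)

/-- **An admissible subspace lies in the dual model of its encoded profile.**
[cite: ConnerHarperLandsberg2023, §6] -/
theorem IsAdmissible.le_dualModel [CharZero K] {E : Submodule K (I9' × I9' → K)} (hE : IsAdmissible E) :
    E ≤ dualModel (encodeProf (fun jk => rootSet E jk.1 jk.2) (δOf E)) :=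
  hE.le_model.trans (model_le_dualModel _ _ (fun jk ii' h => (mem_rootSet.1
    (show (ii'.1, ii'.2) ∈ rootSet E jk.1 jk.2 from h)).1) _)

end MatMul3

end BorderApolarity

end Literature.Computability.AlgebraicComplexity
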